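import Summits.HodgeConjecture.HodgeConjecture.Theorems.R90S3TransportTauWeyl      -- ★ PART 1 (this seat): `coe_fst_transport`, `coe_transport₃`, `finTau_transport`, `finWeylRatio_transport` (brings ★ G1-a p863354)
import Summits.HodgeConjecture.HodgeConjecture.Theorems.R90S3TransportNormPair       -- ★ p863138 (this seat): `isLocalNormPair_transport_iff`, `finExplicitDelta_transport_of_not_isLocalNormPair` (brings ★ p862979 `isConj_map_ringEquiv_iff` …)
import Summits.HodgeConjecture.HodgeConjecture.Theorems.R90S3TransportFormSignAt     -- ★ p863112 (this seat): `subsingleton_placesOver_transport_iff` (non-splitness transports)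
import Literature.NumberTheory.Automorphic.UnitaryGroupLocalCongr                     -- ★ `UnitaryGroup.adelicForm_map_adeleToLocal` (`(H ⊗ 1)_v = H.map (algebraMap …)`)
import HarnessLib

/-!
# R90-TF · S3 wave 4 (J-S3-3), BRICK G1 (PART 2: `κ_v` + HEAD): ROGAWSKI'S EXPLICIT FACTOR `Δ‴_v = τ_v · D_{G∕H,v} · κ_v` TRANSPORTS ALONG A GROUND-FIELD CHANGE
# (`Theorems/R90S3TransportDelta.lean` — pays socket `stub_R90_S3_transport_delta` of `Cruxes/H413/Lines/R90_S3_LocalTransportWaveG.lean` :91 BY ITS BYTES;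
# §1–§3 (`τ_v`, `D_{G∕H,v}`) are PART 1 ★ `Theorems/R90S3TransportTauWeyl.lean`, split at the 400-line lint)

Cell `hodgecm-mathlib`, crux H413 (`stmt-HodgeConjecture-24833`), route of record `HCCMUnconditional`; programme R90-TF, section S3 (base `R90-C12`), wave 4 «LOCAL TRANSPORT»
(S3-R12; dealer R90-C12-plan (g2): «G1 → K2E4-p14 g12, census-first» 23:19:08Z, RULING S3-R18 23:36:50Z «NO re-cut of G1; (T-abs) is a LEMMA = G1-a, then G1-b = the value
half (τ via hΦμ, κ via ★ p863112, D via G1-a) ⇒ G1 closes OUTRIGHT»).  Seat K2E4-p14 (g12).  Lane `--supports stmt-HodgeConjecture-24833 --as helper`; THEOREMS ONLY; ★-only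
imports (a `Theorems/` file never imports `Cruxes/…/Lines`); ns `…R90.S3`.  Lines-side pay line (typist's pen, G ED. n): `stub_R90_S3_transport_delta … := finExplicitDelta_transport …`
(same binders in the same order).

THE MATHEMATICS [Rogawski1990 §4.9 p. 55; §4.3 p. 43; §14.6 p. 242; §3.5 Prop. 3.5.2 (c) p. 29].  ★ `finExplicitDelta L v H′ γ_H μ γ` is `τ_v(γ_H) · D_{G∕H,v}(γ_H) · κ_v(γ_H, γ)` on
the matching pairs and `0` off them (★ p863138 settles the support half and the matching condition).  Along the S3 currency — `Φ : R_v ≃+* R′_{v′}` bicontinuous (`hc`, `hc′`),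
intertwining the conjugations (`hΦσ`), carrying the form (`hΦH : Φ(H′ ⊗ 1) = H″ ⊗ 1`) and the character (`hΦμ : μ′_{v′} ∘ Φ = μ_v` on units), with `e₃, e₂, e₁, e_H = (e₂, e₁)` acting
ENTRYWISE by `Φ` (`heₙ`, `heH`) — every ingredient is carried by `Φ`:
* (PART 1) §1 (entries) `ι`-free coordinates: `(e_H γ_H).1 = Φ·g`, `(e_H γ_H).2 = Φ·γ₂`, `e₃ γ = Φ·γ` as matrices;
* (PART 1) §2 (τ) `γ₂ ↦ Φ γ₂`, `χ_g ↦ χ_g^Φ` (Mathlib `Matrix.charpoly_map`), `χ_g(γ₂) ↦ Φ(χ_g(γ₂))`, `det g⁻¹ ↦ Φ(det g⁻¹)`, and `μ′_{v′}(Φ x) = μ_v(x)` (`hΦμ`; units ↔ units) ⇒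
  `τ_{v′}(e_H γ_H) = τ_v(γ_H)` (`finTau_transport`);
* (PART 1) §3 (D) `D_{G∕H,v′}(e_H γ_H) = √(∏_{w′} ‖Φ(χ_g(γ₂))_{w′}‖) = √(∏_w ‖χ_g(γ₂)_w‖) = D_{G∕H,v}(γ_H)` by G1-a ★ `prod_norm_map_ringEquiv_of_continuous` (`finWeylRatio_transport`);
* §4 (κ) `P_{v′} = Φ·P_v` entrywise (`finEigenlineProjector_transport`), so `P_{v′} = 0 ⟺ P_v = 0`, the first non-zero column index is the same (`Fin.find_congr'`), the local form
  is `Φ`-carried (`hΦH` + ★ `adelicForm_map_adeleToLocal`), hence `x_{v′} = Φ(x_v)` (`finRelPos_transport`); non-splitness transports (★ p863112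
  `subsingleton_placesOver_transport_iff`) and so does the unit-norm test `x = z·z̄` (`hΦσ`, units ↔ units) ⇒ `κ_{v′}(e_H γ_H, e₃ γ) = κ_v(γ_H, γ)` (`finKappaAt_transport`);
* §5 HEAD `finExplicitDelta_transport` = socket G1's conclusion over socket G1's binders VERBATIM.
HONEST LABEL: transport-of-structure bookkeeping, no print input; HC_CM is proved only modulo the 7 printed citations (2 remaining named inputs: hLiu418 = stmt-HodgeConjecture-24832,
h413 = stmt-HodgeConjecture-24833) until rung 0 closes; count-neutral helper — G1 is PAID only when G ED. n plugs `stub_R90_S3_transport_delta := finExplicitDelta_transport …` and is BUILT.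

## References
* [Rogawski1990] J. D. Rogawski, *Automorphic Representations of Unitary Groups in Three Variables*, Ann. of Math. Stud. 123 (1990), §4.9 p. 55; §4.3 p. 43; §14.6 p. 242; §3.5
  Prop. 3.5.2 (c) p. 29.
-/

set_option autoImplicit false
-- the mandated namespace repeats the single-problem summit's segment (`HodgeConjecture.HodgeConjecture`)
set_option linter.dupNamespace false

noncomputable section

open IsDedekindDomain NumberField
open Literature.NumberTheory Literature.NumberTheory.Automorphic Literature.NumberTheory.Automorphic.UnitaryGroup
open Literature.NumberTheory.Rogawski1990 Literature.NumberTheory.GaloisRepresentations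
open scoped Matrix MatrixGroups

namespace Summit.HodgeConjecture.HodgeConjecture.R90.S3

variable (L : Type) [Field L] [NumberField L] [IsCMField L] (H' : Matrix (Fin 3) (Fin 3) L)
  (v : HeightOneSpectrum (𝓞 ↥(maximalRealSubfield L)))

/-! ## §4 (κ): `κ_{v′}(e_H γ_H, e₃ γ) = κ_v(γ_H, γ)` -/

/-- **`P_{v′}(e_H γ_H, e₃ γ) = Φ · P_v(γ_H, γ)`** (`P = γ² − tr(g)·γ + det(g)·1`; trace and determinant commute with `Φ`). [cite: Rogawski1990, §4.9 p. 55] -/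
theorem finEigenlineProjector_transport
    (L' : Type) [Field L'] [NumberField L'] [IsCMField L'] (v' : HeightOneSpectrum (𝓞 ↥(maximalRealSubfield L')))
    (Φ : UnitaryGroup.LocalRing L v ≃+* UnitaryGroup.LocalRing L' v') (H'' : Matrix (Fin 3) (Fin 3) L')
    (e₃ : (UnitaryGroup.cmDatum L 3 H').Local v ≃ₜ* (UnitaryGroup.cmDatum L' 3 H'').Local v')
    (he₃ : ∀ g, ((e₃ g).val : GL (Fin 3) (UnitaryGroup.LocalRing L' v')) = Matrix.GeneralLinearGroup.map (Φ : UnitaryGroup.LocalRing L v →+* UnitaryGroup.LocalRing L' v') (g.val : GL (Fin 3) (UnitaryGroup.LocalRing L v)))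
    (e₂ : (UnitaryGroup.cmDatum L 2 (Matrix.of fun i j : Fin 2 => if i.val + j.val + 1 = 2 then (1 : L) else 0)).Local v ≃ₜ*
      (UnitaryGroup.cmDatum L' 2 (Matrix.of fun i j : Fin 2 => if i.val + j.val + 1 = 2 then (1 : L') else 0)).Local v')
    (he₂ : ∀ g, ((e₂ g).val : GL (Fin 2) (UnitaryGroup.LocalRing L' v')) = Matrix.GeneralLinearGroup.map (Φ : UnitaryGroup.LocalRing L v →+* UnitaryGroup.LocalRing L' v') (g.val : GL (Fin 2) (UnitaryGroup.LocalRing L v)))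
    (e₁ : (UnitaryGroup.cmDatum L 1 (Matrix.of fun i j : Fin 1 => if i.val + j.val + 1 = 1 then (1 : L) else 0)).Local v ≃ₜ*
      (UnitaryGroup.cmDatum L' 1 (Matrix.of fun i j : Fin 1 => if i.val + j.val + 1 = 1 then (1 : L') else 0)).Local v')
    (eH : ((UnitaryGroup.cmDatum L 2 (Matrix.of fun i j : Fin 2 => if i.val + j.val + 1 = 2 then (1 : L) else 0)).Local v ×
      (UnitaryGroup.cmDatum L 1 (Matrix.of fun i j : Fin 1 => if i.val + j.val + 1 = 1 then (1 : L) else 0)).Local v) ≃ₜ*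
      ((UnitaryGroup.cmDatum L' 2 (Matrix.of fun i j : Fin 2 => if i.val + j.val + 1 = 2 then (1 : L') else 0)).Local v' ×
      (UnitaryGroup.cmDatum L' 1 (Matrix.of fun i j : Fin 1 => if i.val + j.val + 1 = 1 then (1 : L') else 0)).Local v'))
    (heH : ∀ h, eH h = (e₂ h.1, e₁ h.2))
    (γH : ((UnitaryGroup.cmDatum L 2 (Matrix.of fun i j : Fin 2 => if i.val + j.val + 1 = 2 then (1 : L) else 0)).Local v ×
      (UnitaryGroup.cmDatum L 1 (Matrix.of fun i j : Fin 1 => if i.val + j.val + 1 = 1 then (1 : L) else 0)).Local v))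
    (γ : (UnitaryGroup.cmDatum L 3 H').Local v) :
    finEigenlineProjector L' v' H'' (eH γH) (e₃ γ) = (finEigenlineProjector L v H' γH γ).map Φ := by
  unfold finEigenlineProjector
  dsimp only
  rw [coe_fst_transport L v L' v' Φ e₂ he₂ e₁ eH heH γH, coe_transport₃ L H' v L' v' Φ H'' e₃ he₃ γ]
  have htr : ((γH.1.val.val : Matrix (Fin 2) (Fin 2) (UnitaryGroup.LocalRing L v)).map Φ).trace =
      Φ (γH.1.val.val : Matrix (Fin 2) (Fin 2) (UnitaryGroup.LocalRing L v)).trace := by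
    simp only [Matrix.trace, Matrix.diag_apply, Matrix.map_apply, map_sum]
  have hdet : ((γH.1.val.val : Matrix (Fin 2) (Fin 2) (UnitaryGroup.LocalRing L v)).map Φ).det =
      Φ (γH.1.val.val : Matrix (Fin 2) (Fin 2) (UnitaryGroup.LocalRing L v)).det :=
    ((Φ : UnitaryGroup.LocalRing L v →+* UnitaryGroup.LocalRing L' v').map_det _).symm
  rw [htr, hdet]
  ext i j
  simp only [Matrix.add_apply, Matrix.sub_apply, Matrix.smul_apply, Matrix.mul_apply, Matrix.map_apply, Matrix.one_apply, smul_eq_mul,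
    map_add, map_sub, map_mul, map_sum, apply_ite Φ, map_one, map_zero]

/-- `Φ · M = 0 ⟺ M = 0` for the entrywise action of the ring isomorphism `Φ`. [folklore] -/
theorem map_ringEquiv_eq_zero_iff
    {R R' : Type*} [NonAssocSemiring R] [NonAssocSemiring R'] {m n : Type*} (Φ : R ≃+* R') (M : Matrix m n R) :
    M.map Φ = 0 ↔ M = 0 := by
  constructor
  · intro h
    ext i j
    have hij := congr_fun (congr_fun h i) j
    rw [Matrix.map_apply, Matrix.zero_apply] at hij
    exact (map_eq_zero_iff Φ Φ.injective).1 hij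
  · rintro rfl
    exact Matrix.map_zero Φ (map_zero Φ)

omit [IsCMField L] in
/-- The local form is `Φ`-carried under the exact pair `hΦH`: `(H″ ⊗ 1)_{v′} = Φ · (H′ ⊗ 1)_v` (★ `adelicForm_map_adeleToLocal`). [cite: Rogawski1990, §4.9 p. 54] -/
theorem localForm_transport
    (L' : Type) [Field L'] [NumberField L'] (v' : HeightOneSpectrum (𝓞 ↥(maximalRealSubfield L')))
    (Φ : UnitaryGroup.LocalRing L v ≃+* UnitaryGroup.LocalRing L' v') (H'' : Matrix (Fin 3) (Fin 3) L')
    (hΦH : (H'.map (algebraMap L (UnitaryGroup.LocalRing L v))).map Φ = H''.map (algebraMap L' (UnitaryGroup.LocalRing L' v'))) :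
    (UnitaryGroup.adelicForm L' 3 H'').map (UnitaryGroup.adeleToLocal L' v') = ((UnitaryGroup.adelicForm L 3 H').map (UnitaryGroup.adeleToLocal L v)).map Φ := by
  rw [UnitaryGroup.adelicForm_map_adeleToLocal, UnitaryGroup.adelicForm_map_adeleToLocal, hΦH]

/-- **`x_j(e_H γ_H, e₃ γ) = Φ(x_j(γ_H, γ))`** for every column `j` (`hΦσ` intertwines the conjugations, `hΦH` carries the form). [cite: Rogawski1990, §3.5 Prop. 3.5.2 (c) p. 29; §4.9 p. 55] -/
theorem finColumnFormValue_transport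
    (L' : Type) [Field L'] [NumberField L'] [IsCMField L'] (v' : HeightOneSpectrum (𝓞 ↥(maximalRealSubfield L')))
    (Φ : UnitaryGroup.LocalRing L v ≃+* UnitaryGroup.LocalRing L' v')
    (hΦσ : ∀ x, Φ ((conjLocal L (IsCMField.complexConj L) v) x) = (conjLocal L' (IsCMField.complexConj L') v') (Φ x))
    (H'' : Matrix (Fin 3) (Fin 3) L')
    (hΦH : (H'.map (algebraMap L (UnitaryGroup.LocalRing L v))).map Φ = H''.map (algebraMap L' (UnitaryGroup.LocalRing L' v')))
    (e₃ : (UnitaryGroup.cmDatum L 3 H').Local v ≃ₜ* (UnitaryGroup.cmDatum L' 3 H'').Local v')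
    (he₃ : ∀ g, ((e₃ g).val : GL (Fin 3) (UnitaryGroup.LocalRing L' v')) = Matrix.GeneralLinearGroup.map (Φ : UnitaryGroup.LocalRing L v →+* UnitaryGroup.LocalRing L' v') (g.val : GL (Fin 3) (UnitaryGroup.LocalRing L v)))
    (e₂ : (UnitaryGroup.cmDatum L 2 (Matrix.of fun i j : Fin 2 => if i.val + j.val + 1 = 2 then (1 : L) else 0)).Local v ≃ₜ*
      (UnitaryGroup.cmDatum L' 2 (Matrix.of fun i j : Fin 2 => if i.val + j.val + 1 = 2 then (1 : L') else 0)).Local v')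
    (he₂ : ∀ g, ((e₂ g).val : GL (Fin 2) (UnitaryGroup.LocalRing L' v')) = Matrix.GeneralLinearGroup.map (Φ : UnitaryGroup.LocalRing L v →+* UnitaryGroup.LocalRing L' v') (g.val : GL (Fin 2) (UnitaryGroup.LocalRing L v)))
    (e₁ : (UnitaryGroup.cmDatum L 1 (Matrix.of fun i j : Fin 1 => if i.val + j.val + 1 = 1 then (1 : L) else 0)).Local v ≃ₜ*
      (UnitaryGroup.cmDatum L' 1 (Matrix.of fun i j : Fin 1 => if i.val + j.val + 1 = 1 then (1 : L') else 0)).Local v')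
    (eH : ((UnitaryGroup.cmDatum L 2 (Matrix.of fun i j : Fin 2 => if i.val + j.val + 1 = 2 then (1 : L) else 0)).Local v ×
      (UnitaryGroup.cmDatum L 1 (Matrix.of fun i j : Fin 1 => if i.val + j.val + 1 = 1 then (1 : L) else 0)).Local v) ≃ₜ*
      ((UnitaryGroup.cmDatum L' 2 (Matrix.of fun i j : Fin 2 => if i.val + j.val + 1 = 2 then (1 : L') else 0)).Local v' ×
      (UnitaryGroup.cmDatum L' 1 (Matrix.of fun i j : Fin 1 => if i.val + j.val + 1 = 1 then (1 : L') else 0)).Local v'))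
    (heH : ∀ h, eH h = (e₂ h.1, e₁ h.2))
    (γH : ((UnitaryGroup.cmDatum L 2 (Matrix.of fun i j : Fin 2 => if i.val + j.val + 1 = 2 then (1 : L) else 0)).Local v ×
      (UnitaryGroup.cmDatum L 1 (Matrix.of fun i j : Fin 1 => if i.val + j.val + 1 = 1 then (1 : L) else 0)).Local v))
    (γ : (UnitaryGroup.cmDatum L 3 H').Local v) (j : Fin 3) :
    finColumnFormValue L' v' H'' (eH γH) (e₃ γ) j = Φ (finColumnFormValue L v H' γH γ j) := by
  unfold finColumnFormValue
  rw [finEigenlineProjector_transport L H' v L' v' Φ H'' e₃ he₃ e₂ he₂ e₁ eH heH γH γ, localForm_transport L H' v L' v' Φ H'' hΦH]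
  simp only [map_sum, map_mul, Matrix.map_apply, hΦσ]

/-- **The relative position transports: `x_{v′}(e_H γ_H, e₃ γ) = Φ(x_v(γ_H, γ))`** — `P_{v′} = Φ·P_v` has the same first non-zero column (`Fin.find_congr'`), whose
`H″_{v′}`-value is `Φ` of the `H′_v`-value. [cite: Rogawski1990, §3.5 Prop. 3.5.2 (c) p. 29; §4.3 p. 43] -/
theorem finRelPos_transport
    (L' : Type) [Field L'] [NumberField L'] [IsCMField L'] (v' : HeightOneSpectrum (𝓞 ↥(maximalRealSubfield L')))
    (Φ : UnitaryGroup.LocalRing L v ≃+* UnitaryGroup.LocalRing L' v')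
    (hΦσ : ∀ x, Φ ((conjLocal L (IsCMField.complexConj L) v) x) = (conjLocal L' (IsCMField.complexConj L') v') (Φ x))
    (H'' : Matrix (Fin 3) (Fin 3) L')
    (hΦH : (H'.map (algebraMap L (UnitaryGroup.LocalRing L v))).map Φ = H''.map (algebraMap L' (UnitaryGroup.LocalRing L' v')))
    (e₃ : (UnitaryGroup.cmDatum L 3 H').Local v ≃ₜ* (UnitaryGroup.cmDatum L' 3 H'').Local v')
    (he₃ : ∀ g, ((e₃ g).val : GL (Fin 3) (UnitaryGroup.LocalRing L' v')) = Matrix.GeneralLinearGroup.map (Φ : UnitaryGroup.LocalRing L v →+* UnitaryGroup.LocalRing L' v') (g.val : GL (Fin 3) (UnitaryGroup.LocalRing L v)))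
    (e₂ : (UnitaryGroup.cmDatum L 2 (Matrix.of fun i j : Fin 2 => if i.val + j.val + 1 = 2 then (1 : L) else 0)).Local v ≃ₜ*
      (UnitaryGroup.cmDatum L' 2 (Matrix.of fun i j : Fin 2 => if i.val + j.val + 1 = 2 then (1 : L') else 0)).Local v')
    (he₂ : ∀ g, ((e₂ g).val : GL (Fin 2) (UnitaryGroup.LocalRing L' v')) = Matrix.GeneralLinearGroup.map (Φ : UnitaryGroup.LocalRing L v →+* UnitaryGroup.LocalRing L' v') (g.val : GL (Fin 2) (UnitaryGroup.LocalRing L v)))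
    (e₁ : (UnitaryGroup.cmDatum L 1 (Matrix.of fun i j : Fin 1 => if i.val + j.val + 1 = 1 then (1 : L) else 0)).Local v ≃ₜ*
      (UnitaryGroup.cmDatum L' 1 (Matrix.of fun i j : Fin 1 => if i.val + j.val + 1 = 1 then (1 : L') else 0)).Local v')
    (eH : ((UnitaryGroup.cmDatum L 2 (Matrix.of fun i j : Fin 2 => if i.val + j.val + 1 = 2 then (1 : L) else 0)).Local v ×
      (UnitaryGroup.cmDatum L 1 (Matrix.of fun i j : Fin 1 => if i.val + j.val + 1 = 1 then (1 : L) else 0)).Local v) ≃ₜ*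
      ((UnitaryGroup.cmDatum L' 2 (Matrix.of fun i j : Fin 2 => if i.val + j.val + 1 = 2 then (1 : L') else 0)).Local v' ×
      (UnitaryGroup.cmDatum L' 1 (Matrix.of fun i j : Fin 1 => if i.val + j.val + 1 = 1 then (1 : L') else 0)).Local v'))
    (heH : ∀ h, eH h = (e₂ h.1, e₁ h.2))
    (γH : ((UnitaryGroup.cmDatum L 2 (Matrix.of fun i j : Fin 2 => if i.val + j.val + 1 = 2 then (1 : L) else 0)).Local v ×
      (UnitaryGroup.cmDatum L 1 (Matrix.of fun i j : Fin 1 => if i.val + j.val + 1 = 1 then (1 : L) else 0)).Local v))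
    (γ : (UnitaryGroup.cmDatum L 3 H').Local v) :
    finRelPos L' v' H'' (eH γH) (e₃ γ) = Φ (finRelPos L v H' γH γ) := by
  classical
  have hP := finEigenlineProjector_transport L H' v L' v' Φ H'' e₃ he₃ e₂ he₂ e₁ eH heH γH γ
  have hiff : ∀ j : Fin 3, (∃ i : Fin 3, finEigenlineProjector L' v' H'' (eH γH) (e₃ γ) i j ≠ 0) ↔ (∃ i : Fin 3, finEigenlineProjector L v H' γH γ i j ≠ 0) := fun j => by
    simp only [hP, Matrix.map_apply, map_ne_zero_iff Φ Φ.injective]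
  unfold finRelPos
  by_cases h : ∃ j : Fin 3, ∃ i : Fin 3, finEigenlineProjector L v H' γH γ i j ≠ 0
  · have h' : ∃ j : Fin 3, ∃ i : Fin 3, finEigenlineProjector L' v' H'' (eH γH) (e₃ γ) i j ≠ 0 := by
      obtain ⟨j, hj⟩ := h
      exact ⟨j, (hiff j).2 hj⟩
    rw [dif_pos h', dif_pos h, finColumnFormValue_transport L H' v L' v' Φ hΦσ H'' hΦH e₃ he₃ e₂ he₂ e₁ eH heH γH γ,
      Fin.find_congr' (p := fun j : Fin 3 => ∃ i : Fin 3, finEigenlineProjector L' v' H'' (eH γH) (e₃ γ) i j ≠ 0)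
        (q := fun j : Fin 3 => ∃ i : Fin 3, finEigenlineProjector L v H' γH γ i j ≠ 0) (hp := h') (hq := h) (fun {j} => hiff j)]
  · have h' : ¬ ∃ j : Fin 3, ∃ i : Fin 3, finEigenlineProjector L' v' H'' (eH γH) (e₃ γ) i j ≠ 0 := by
      rintro ⟨j, hj⟩
      exact h ⟨j, (hiff j).1 hj⟩
    rw [dif_neg h', dif_neg h, map_zero]

/-- **The unit-norm test `r = z · c̄(z)`, `z` a unit, transports along `Φ`** for any `r` (`hΦσ`; units correspond; back along `Φ⁻¹`) — ★ p863112's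
`exists_unit_norm_transport_iff` at a general element. [cite: Rogawski1990, §3.5 Prop. 3.5.2 (c) p. 29; §14.6 p. 242] -/
theorem exists_unit_mul_conj_transport_iff
    (L' : Type) [Field L'] [NumberField L'] [IsCMField L'] (v' : HeightOneSpectrum (𝓞 ↥(maximalRealSubfield L')))
    (Φ : UnitaryGroup.LocalRing L v ≃+* UnitaryGroup.LocalRing L' v')
    (hΦσ : ∀ x, Φ ((conjLocal L (IsCMField.complexConj L) v) x) = (conjLocal L' (IsCMField.complexConj L') v') (Φ x))
    (r : UnitaryGroup.LocalRing L v) :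
    (∃ z' : UnitaryGroup.LocalRing L' v', IsUnit z' ∧ Φ r = z' * conjLocal L' (IsCMField.complexConj L') v' z') ↔
      (∃ z : UnitaryGroup.LocalRing L v, IsUnit z ∧ r = z * conjLocal L (IsCMField.complexConj L) v z) := by
  constructor
  · rintro ⟨z', hz', h'⟩
    refine ⟨Φ.symm z', hz'.map Φ.symm, Φ.injective ?_⟩
    rw [h', map_mul, hΦσ, RingEquiv.apply_symm_apply]
  · rintro ⟨z, hz, h⟩
    exact ⟨Φ z, hz.map Φ, by rw [h, map_mul, hΦσ]⟩

/-- **(κ) `κ_{v′}(e_H γ_H, e₃ γ) = κ_v(γ_H, γ)`** — every branch of ★ `finKappaAt` transports: `P = 0` (`finEigenlineProjector_transport`), non-splitness (★ p863112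
`subsingleton_placesOver_transport_iff`), and the unit-norm test at `x_v` (`finRelPos_transport` + `exists_unit_mul_conj_transport_iff`).
[cite: Rogawski1990, §14.6 p. 242; §4.3 p. 43; §3.5 Prop. 3.5.2 (c) p. 29] -/
theorem finKappaAt_transport
    (L' : Type) [Field L'] [NumberField L'] [IsCMField L'] (v' : HeightOneSpectrum (𝓞 ↥(maximalRealSubfield L')))
    (Φ : UnitaryGroup.LocalRing L v ≃+* UnitaryGroup.LocalRing L' v')
    (hΦσ : ∀ x, Φ ((conjLocal L (IsCMField.complexConj L) v) x) = (conjLocal L' (IsCMField.complexConj L') v') (Φ x))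
    (H'' : Matrix (Fin 3) (Fin 3) L')
    (hΦH : (H'.map (algebraMap L (UnitaryGroup.LocalRing L v))).map Φ = H''.map (algebraMap L' (UnitaryGroup.LocalRing L' v')))
    (e₃ : (UnitaryGroup.cmDatum L 3 H').Local v ≃ₜ* (UnitaryGroup.cmDatum L' 3 H'').Local v')
    (he₃ : ∀ g, ((e₃ g).val : GL (Fin 3) (UnitaryGroup.LocalRing L' v')) = Matrix.GeneralLinearGroup.map (Φ : UnitaryGroup.LocalRing L v →+* UnitaryGroup.LocalRing L' v') (g.val : GL (Fin 3) (UnitaryGroup.LocalRing L v)))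
    (e₂ : (UnitaryGroup.cmDatum L 2 (Matrix.of fun i j : Fin 2 => if i.val + j.val + 1 = 2 then (1 : L) else 0)).Local v ≃ₜ*
      (UnitaryGroup.cmDatum L' 2 (Matrix.of fun i j : Fin 2 => if i.val + j.val + 1 = 2 then (1 : L') else 0)).Local v')
    (he₂ : ∀ g, ((e₂ g).val : GL (Fin 2) (UnitaryGroup.LocalRing L' v')) = Matrix.GeneralLinearGroup.map (Φ : UnitaryGroup.LocalRing L v →+* UnitaryGroup.LocalRing L' v') (g.val : GL (Fin 2) (UnitaryGroup.LocalRing L v)))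
    (e₁ : (UnitaryGroup.cmDatum L 1 (Matrix.of fun i j : Fin 1 => if i.val + j.val + 1 = 1 then (1 : L) else 0)).Local v ≃ₜ*
      (UnitaryGroup.cmDatum L' 1 (Matrix.of fun i j : Fin 1 => if i.val + j.val + 1 = 1 then (1 : L') else 0)).Local v')
    (eH : ((UnitaryGroup.cmDatum L 2 (Matrix.of fun i j : Fin 2 => if i.val + j.val + 1 = 2 then (1 : L) else 0)).Local v ×
      (UnitaryGroup.cmDatum L 1 (Matrix.of fun i j : Fin 1 => if i.val + j.val + 1 = 1 then (1 : L) else 0)).Local v) ≃ₜ*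
      ((UnitaryGroup.cmDatum L' 2 (Matrix.of fun i j : Fin 2 => if i.val + j.val + 1 = 2 then (1 : L') else 0)).Local v' ×
      (UnitaryGroup.cmDatum L' 1 (Matrix.of fun i j : Fin 1 => if i.val + j.val + 1 = 1 then (1 : L') else 0)).Local v'))
    (heH : ∀ h, eH h = (e₂ h.1, e₁ h.2))
    (γH : ((UnitaryGroup.cmDatum L 2 (Matrix.of fun i j : Fin 2 => if i.val + j.val + 1 = 2 then (1 : L) else 0)).Local v ×
      (UnitaryGroup.cmDatum L 1 (Matrix.of fun i j : Fin 1 => if i.val + j.val + 1 = 1 then (1 : L) else 0)).Local v))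
    (γ : (UnitaryGroup.cmDatum L 3 H').Local v) :
    finKappaAt L' v' H'' (eH γH) (e₃ γ) = finKappaAt L v H' γH γ := by
  have hP0 : finEigenlineProjector L' v' H'' (eH γH) (e₃ γ) = 0 ↔ finEigenlineProjector L v H' γH γ = 0 := by
    rw [finEigenlineProjector_transport L H' v L' v' Φ H'' e₃ he₃ e₂ he₂ e₁ eH heH γH γ]
    exact map_ringEquiv_eq_zero_iff Φ _
  have hsub := subsingleton_placesOver_transport_iff L v L' v' Φ
  have hex : (∃ z' : UnitaryGroup.LocalRing L' v', IsUnit z' ∧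
        finRelPos L' v' H'' (eH γH) (e₃ γ) = z' * conjLocal L' (IsCMField.complexConj L') v' z') ↔
      (∃ z : UnitaryGroup.LocalRing L v, IsUnit z ∧ finRelPos L v H' γH γ = z * conjLocal L (IsCMField.complexConj L) v z) := by
    rw [finRelPos_transport L H' v L' v' Φ hΦσ H'' hΦH e₃ he₃ e₂ he₂ e₁ eH heH γH γ]
    exact exists_unit_mul_conj_transport_iff L v L' v' Φ hΦσ _
  unfold finKappaAt
  by_cases h0 : finEigenlineProjector L v H' γH γ = 0
  · rw [if_pos h0, if_pos (hP0.2 h0)]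
  · rw [if_neg h0, if_neg (fun h => h0 (hP0.1 h))]
    by_cases hs : Subsingleton (UnitaryGroup.PlacesOver L v)
    · rw [if_neg (not_not.2 hs), if_neg (not_not.2 (hsub.1 hs))]
      by_cases he : ∃ z : UnitaryGroup.LocalRing L v, IsUnit z ∧ finRelPos L v H' γH γ = z * conjLocal L (IsCMField.complexConj L) v z
      · rw [if_pos he, if_pos (hex.2 he)]
      · rw [if_neg he, if_neg (fun h => he (hex.1 h))]
    · rw [if_pos hs, if_pos (fun h => hs (hsub.2 h))]

/-! ## §5 HEAD — socket G1 `stub_R90_S3_transport_delta` (binders and conclusion VERBATIM) -/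

/-- **BRICK G1 — ROGAWSKI'S EXPLICIT TRANSFER FACTOR `Δ‴_v` IS TRANSPORTED ALONG THE GROUND-FIELD CHANGE**: under the exact pair `hΦH` and `hΦμ : μ′_{v′} ∘ Φ = μ_v` on
units, `Δ‴_{v′}(e_H γ_H, e₃ γ; H″, μ′) = Δ‴_v(γ_H, γ; H′, μ)`.  Binders = socket `stub_R90_S3_transport_delta` of `Cruxes/H413/Lines/R90_S3_LocalTransportWaveG.lean` :91 VERBATIM
(currency `(L′, v′, Φ, hc, hc′, hΦσ)`, exact form pair `(H″, hΦH)`, characters `(μ, μ′, hΦμ)`, isomorphisms `e₃ he₃ e₂ he₂ e₁ he₁ eH heH`, then `γH γ`); conclusion = the socket's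
BYTES.  Proof: off the matching pairs both sides vanish (★ p863138); on them `Δ‴ = τ · D · κ` (★ `finExplicitDelta_of_isLocalNormPair`) and each factor transports (§2 `finTau_transport`,
§3 `finWeylRatio_transport` via G1-a, §4 `finKappaAt_transport`). [cite: Rogawski1990, §4.9 p. 55; §4.3 p. 43; §14.6 p. 242] -/
theorem finExplicitDelta_transport
    (L' : Type) [Field L'] [NumberField L'] [IsCMField L'] (v' : HeightOneSpectrum (𝓞 ↥(maximalRealSubfield L')))
    (Φ : UnitaryGroup.LocalRing L v ≃+* UnitaryGroup.LocalRing L' v') (hc : Continuous Φ) (hc' : Continuous Φ.symm)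
    (hΦσ : ∀ x, Φ ((conjLocal L (IsCMField.complexConj L) v) x) = (conjLocal L' (IsCMField.complexConj L') v') (Φ x))
    (H'' : Matrix (Fin 3) (Fin 3) L')
    (hΦH : (H'.map (algebraMap L (UnitaryGroup.LocalRing L v))).map Φ = H''.map (algebraMap L' (UnitaryGroup.LocalRing L' v')))
    (μ : HeckeCharacter L) (μ' : HeckeCharacter L')
    (hΦμ : ∀ u : (UnitaryGroup.LocalRing L v)ˣ,
      μ'.semilocalComponent L' v' (Units.map (Φ : UnitaryGroup.LocalRing L v →+* UnitaryGroup.LocalRing L' v').toMonoidHom u) = μ.semilocalComponent L v u)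
    (e₃ : (UnitaryGroup.cmDatum L 3 H').Local v ≃ₜ* (UnitaryGroup.cmDatum L' 3 H'').Local v')
    (he₃ : ∀ g, ((e₃ g).val : GL (Fin 3) (UnitaryGroup.LocalRing L' v')) = Matrix.GeneralLinearGroup.map (Φ : UnitaryGroup.LocalRing L v →+* UnitaryGroup.LocalRing L' v') (g.val : GL (Fin 3) (UnitaryGroup.LocalRing L v)))
    (e₂ : (UnitaryGroup.cmDatum L 2 (Matrix.of fun i j : Fin 2 => if i.val + j.val + 1 = 2 then (1 : L) else 0)).Local v ≃ₜ*
      (UnitaryGroup.cmDatum L' 2 (Matrix.of fun i j : Fin 2 => if i.val + j.val + 1 = 2 then (1 : L') else 0)).Local v')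
    (he₂ : ∀ g, ((e₂ g).val : GL (Fin 2) (UnitaryGroup.LocalRing L' v')) = Matrix.GeneralLinearGroup.map (Φ : UnitaryGroup.LocalRing L v →+* UnitaryGroup.LocalRing L' v') (g.val : GL (Fin 2) (UnitaryGroup.LocalRing L v)))
    (e₁ : (UnitaryGroup.cmDatum L 1 (Matrix.of fun i j : Fin 1 => if i.val + j.val + 1 = 1 then (1 : L) else 0)).Local v ≃ₜ*
      (UnitaryGroup.cmDatum L' 1 (Matrix.of fun i j : Fin 1 => if i.val + j.val + 1 = 1 then (1 : L') else 0)).Local v')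
    (he₁ : ∀ g, ((e₁ g).val : GL (Fin 1) (UnitaryGroup.LocalRing L' v')) = Matrix.GeneralLinearGroup.map (Φ : UnitaryGroup.LocalRing L v →+* UnitaryGroup.LocalRing L' v') (g.val : GL (Fin 1) (UnitaryGroup.LocalRing L v)))
    (eH : ((UnitaryGroup.cmDatum L 2 (Matrix.of fun i j : Fin 2 => if i.val + j.val + 1 = 2 then (1 : L) else 0)).Local v ×
      (UnitaryGroup.cmDatum L 1 (Matrix.of fun i j : Fin 1 => if i.val + j.val + 1 = 1 then (1 : L) else 0)).Local v) ≃ₜ*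
      ((UnitaryGroup.cmDatum L' 2 (Matrix.of fun i j : Fin 2 => if i.val + j.val + 1 = 2 then (1 : L') else 0)).Local v' ×
      (UnitaryGroup.cmDatum L' 1 (Matrix.of fun i j : Fin 1 => if i.val + j.val + 1 = 1 then (1 : L') else 0)).Local v'))
    (heH : ∀ h, eH h = (e₂ h.1, e₁ h.2))
    (γH : ((UnitaryGroup.cmDatum L 2 (Matrix.of fun i j : Fin 2 => if i.val + j.val + 1 = 2 then (1 : L) else 0)).Local v ×
      (UnitaryGroup.cmDatum L 1 (Matrix.of fun i j : Fin 1 => if i.val + j.val + 1 = 1 then (1 : L) else 0)).Local v))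
    (γ : (UnitaryGroup.cmDatum L 3 H').Local v) :
    finExplicitDelta L' v' H'' (eH γH) μ' (e₃ γ) = finExplicitDelta L v H' γH μ γ := by
  by_cases h : IsLocalNormPair L H' v γH γ
  · have h' : IsLocalNormPair L' H'' v' (eH γH) (e₃ γ) := (isLocalNormPair_transport_iff L H' v L' v' Φ H'' e₃ he₃ e₂ he₂ e₁ he₁ eH heH γH γ).2 h
    rw [finExplicitDelta_of_isLocalNormPair L v H' γH μ h, finExplicitDelta_of_isLocalNormPair L' v' H'' (eH γH) μ' h',
      finTau_transport L v L' v' Φ μ μ' hΦμ e₂ he₂ e₁ he₁ eH heH γH, finWeylRatio_transport L v L' v' Φ hc hc' e₂ he₂ e₁ he₁ eH heH γH,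
      finKappaAt_transport L H' v L' v' Φ hΦσ H'' hΦH e₃ he₃ e₂ he₂ e₁ eH heH γH γ]
  · exact finExplicitDelta_transport_of_not_isLocalNormPair L H' v L' v' Φ H'' μ μ' e₃ he₃ e₂ he₂ e₁ he₁ eH heH h

end Summit.HodgeConjecture.HodgeConjecture.R90.S3

end
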